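import Mathlib
import Literature.AlgebraicGeometry.Resolution.CobordantGame
import Literature.AlgebraicGeometry.Resolution.CobordantChartCoefficients
import Literature.AlgebraicGeometry.Resolution.CobordantTupleGame
import Literature.AlgebraicGeometry.Resolution.FormalCoordinateChange
import Summits.ResolutionOfSingularities.ResolutionOfSingularities.Theorems.WeightedInvariantGlobalizeLocalDropCanonize
import Summits.ResolutionOfSingularities.ResolutionOfSingularities.Theorems.WeightedInvariantLocalWeightedDropTangentConeCut
import Summits.ResolutionOfSingularities.ResolutionOfSingularities.Theorems.WeightedInvariantLocalWeightedDropMonicPointBlowup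
import Summits.ResolutionOfSingularities.ResolutionOfSingularities.Theorems.WeightedInvariantLocalWeightedDropMonicCurveBlowup
import Summits.ResolutionOfSingularities.ResolutionOfSingularities.Theorems.WeightedInvariantLocalWeightedDropMonicRecentre
import Summits.ResolutionOfSingularities.ResolutionOfSingularities.Theorems.WeightedInvariantLocalWeightedDropMonicDoublePointLift
import Summits.ResolutionOfSingularities.ResolutionOfSingularities.Theorems.WeightedInvariantLocalWeightedDropCharTwoDoublePointMonic
import Summits.ResolutionOfSingularities.ResolutionOfSingularities.Theorems.WeightedInvariantLocalWeightedDropPlaneWon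

/-!
# `WeightedInvariant.LocalWeightedDrop`, line `hasse-ridge-face-selection`: the monic double-point lift with FORMAL re-presentations (N4′)

Crux item stmt-ResolutionOfSingularities-8899 `LocalWeightedDrop` (route `ResolutionOfSingularities/WeightedInvariant`), serving
the door `WeightedConstruction` stmt-ResolutionOfSingularities-0571.  [OURS · L1 W4.3, chain w43, lead prover: reshaped sub-stub N4′
of the piece S2 `stub_charTwoDoublePointSurfaceWon` of skeleton v20/v21.  Not a statement of any manuscript.]

Why this file exists: the candidate sub-stub N4 (`stub_monicDoublePointRank`, evidence on stmt-8899, never registered) granted the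
rank player only LINEAR renormalisations `S ∘ M` of the successors.  That statement is FALSE in characteristic `2`: for
`A₁ = 0`, `A₀ = g³`, `g = x₁ + x₂ + x₁x₂` one has `g(x₁, x₁(x₂+1)) = x₁ · g` verbatim, so the exceptional point `(1:1)` reproduces
`y² + x₁ⁿ g³ ↦ y² + x₁ⁿ⁺¹ g³` and the curve blow-up `V(x₁, y)` sends `n ↦ n − 2`: an exact period-3 cycle of legal, singular,
square-quadric positions, while the regular double curve `V(y, g)` is never a coordinate axis in linear coordinates (evidence
`N4-MISSTATED.md` on stmt-8899).  In the full game the Prover owns arbitrary FORMAL coordinate changes (`won_subst_iff`), under which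
the same germ is the cuspidal cylinder `y² + v³`, won in one move.

`monicDoublePointsWon_of_formalRank` (N3′): the lift `monicDoublePointsWon_of_rank` (p470030) with the rank player's freedom enlarged to
what `CobordantGame.Won` really grants — (a) a formal RE-PRESENTATION of the position before the move
(`θ₀^* (y² + A₁y + A₀) = H₀ · (y² + Ã₁y + Ã₀)`, `θ₀` any substitution with zero constant terms and invertible linear part, `H₀(0) ≠ 0`),
then the re-centring `φ` and one of the two landed bricks (point blow-up / permissible curve blow-up `V(x_i, y)`) applied to `Ã`, and
(b) at every singular slice either the hyperbolic exit or a FORMAL renormalisation `θ^* S = H · (y² + A₁′y + A₀′)` to a position of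
smaller rank.  Proof: well-founded induction on `κ`; `won_subst_iff`, `won_unit_mul_iff`, `won_monic_two_recentre_iff`, the bricks,
`TangentConeCut.hyperbolicStartsWon` — exactly as p470030.

`charTwoDoublePointSurfaceWon_of_formalRank`: at `n = 0`, `p = 2`, `k = k̄` the existence of such a rank (statement N4′, the hypothesis,
spelled out verbatim) yields the registered piece S2 `stub_charTwoDoublePointSurfaceWon` VERBATIM (through
`charTwoDoublePointSurfaceWon_of_monicForms`, p468075, and `PlaneWon.lineWon`).  N4′ — the char-`2` surface double-point descent in
the form the polygon laws can feed (CJS LNM 2270 Ch. 11–13: `β` non-increasing over fundamental units, then the `ζ`-drop; positional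
rank extracted from the terminating history-dependent strategy) — is the S2 sub-stub of skeleton v21.
-/

set_option linter.dupNamespace false -- mandated namespace of this single-conjunct summit

namespace Summit.ResolutionOfSingularities.ResolutionOfSingularities.Theorems

open Literature.AlgebraicGeometry.Resolution
open Literature.AlgebraicGeometry.Resolution.CobordantGame

open MonicDoublePointLift MvPowerSeries in
/-- N3′ — THE LIFT FOR MONIC DOUBLE POINTS WITH FORMAL RE-PRESENTATIONS (every characteristic `p`, `N = n + 3` variables).
Suppose every singular germ in `n + 1` variables is won (`hlow`) and there is an ordinal RANK `κ` on the pairs `(A₀, A₁)` with the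
FORMAL STEP PROPERTY `hstep`: from every position (`ord A₀ ≥ 3`, `ord A₁ ≥ 2`) the rank player names
(a) a formal re-presentation `θ₀^*(y² + A₁y + A₀) = H₀ · (y² + Ã₁y + Ã₀)` of the same germ as a position (`θ₀` with zero constant
terms and invertible linear part, `H₀(0) ≠ 0`; e.g. `θ₀ = id`), (b) a re-centring `φ` of `Ã` keeping the position shape, and
(c) EITHER the point blow-up OR a permissible curve blow-up `V(x_i, y)` of the re-centred `Ã` (with its divisibility data), such that
every SINGULAR slice `S` of the corresponding landed brick is GOOD: it carries a hyperbolic-quadric witness, or the rank player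
renormalises it FORMALLY — `θ^* S = H · (y² + A₁′y + A₀′)`, `θ` with zero constant terms and invertible linear part, `H(0) ≠ 0`,
`ord A₀′ ≥ 3`, `ord A₁′ ≥ 2` — to a position of SMALLER RANK than `(A₀, A₁)`.  Then every monic double point is won.
[OURS; the formal-coordinate-change version of `monicDoublePointsWon_of_rank`.] -/
theorem monicDoublePointsWon_of_formalRank (p : ℕ) (hp : p.Prime) (k : Type) [Field k] [CharP k p] (n : ℕ)
    (hlow : ∀ g : MvPowerSeries (Fin (n + 1)) k, CobordantGame.IsSingular k g → CobordantGame.Won k (n + 1) g)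
    (κ : MvPowerSeries (Fin (n + 2)) k → MvPowerSeries (Fin (n + 2)) k → Ordinal.{0})
    (hstep : ∀ A₀ A₁ : MvPowerSeries (Fin (n + 2)) k, (2 : ℕ∞) < A₀.order → (1 : ℕ∞) < A₁.order →
      ∃ (θ₀ : Fin (n + 3) → MvPowerSeries (Fin (n + 3)) k) (H₀ : MvPowerSeries (Fin (n + 3)) k)
        (B₀ B₁ : MvPowerSeries (Fin (n + 2)) k),
        (∀ i, MvPowerSeries.constantCoeff (θ₀ i) = 0) ∧ IsUnit (FormalCoordChange.linMat θ₀).det ∧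
        MvPowerSeries.constantCoeff H₀ ≠ 0 ∧ (2 : ℕ∞) < B₀.order ∧ (1 : ℕ∞) < B₁.order ∧
        MvPowerSeries.subst θ₀ (MvPowerSeries.X (Fin.last (n + 2)) ^ 2 +
            (MvPowerSeries.rename (Fin.succAboveEmb (Fin.last (n + 2))) A₀ +
              MvPowerSeries.rename (Fin.succAboveEmb (Fin.last (n + 2))) A₁ * MvPowerSeries.X (Fin.last (n + 2)))) =
          H₀ * (MvPowerSeries.X (Fin.last (n + 2)) ^ 2 +
            (MvPowerSeries.rename (Fin.succAboveEmb (Fin.last (n + 2))) B₀ +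
              MvPowerSeries.rename (Fin.succAboveEmb (Fin.last (n + 2))) B₁ * MvPowerSeries.X (Fin.last (n + 2)))) ∧
      ∃ φ : MvPowerSeries (Fin (n + 2)) k, MvPowerSeries.constantCoeff φ = 0 ∧
        (2 : ℕ∞) < (B₀ + B₁ * φ + φ ^ 2).order ∧ (1 : ℕ∞) < (B₁ + 2 * φ).order ∧
        let good : MvPowerSeries (Fin (n + 3)) k → Prop := fun S =>
          (∃ θ : Fin (n + 3) → MvPowerSeries (Fin (n + 3)) k, (∀ i, MvPowerSeries.constantCoeff (θ i) = 0) ∧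
            IsUnit (Matrix.det (Matrix.of fun i j => MvPowerSeries.coeff (Finsupp.single j 1) (θ i))) ∧
            MvPowerSeries.coeff (Finsupp.single 0 2) (MvPowerSeries.subst θ S) = 0 ∧
            MvPowerSeries.coeff (Finsupp.single 1 2) (MvPowerSeries.subst θ S) = 0 ∧
            MvPowerSeries.coeff (Finsupp.single 0 1 + Finsupp.single 1 1) (MvPowerSeries.subst θ S) ≠ 0) ∨
          (∃ (θ : Fin (n + 3) → MvPowerSeries (Fin (n + 3)) k) (H : MvPowerSeries (Fin (n + 3)) k)
              (A₀' A₁' : MvPowerSeries (Fin (n + 2)) k),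
            (∀ i, MvPowerSeries.constantCoeff (θ i) = 0) ∧ IsUnit (FormalCoordChange.linMat θ).det ∧
            MvPowerSeries.constantCoeff H ≠ 0 ∧ (2 : ℕ∞) < A₀'.order ∧ (1 : ℕ∞) < A₁'.order ∧
            MvPowerSeries.subst θ S =
              H * (MvPowerSeries.X (Fin.last (n + 2)) ^ 2 +
                (MvPowerSeries.rename (Fin.succAboveEmb (Fin.last (n + 2))) A₀' +
                  MvPowerSeries.rename (Fin.succAboveEmb (Fin.last (n + 2))) A₁' * MvPowerSeries.X (Fin.last (n + 2)))) ∧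
            κ A₀' A₁' < κ A₀ A₁)
        ((∀ (c : Fin (n + 2) → k) (i₀ : Fin (n + 2)), c i₀ ≠ 0 → ∀ Bv : Fin 2 → MvPowerSeries (Fin (n + 3)) k,
            (∀ j : Fin 2, MvPowerSeries.subst (CobordantChart.chart (fun _ : Fin (n + 2) => 1) c)
              ((![B₀ + B₁ * φ + φ ^ 2, B₁ + 2 * φ] : Fin 2 → MvPowerSeries (Fin (n + 2)) k) j) =
              MvPowerSeries.X 0 ^ (2 - (j : ℕ) + 1) * Bv j) →
            ∀ S : MvPowerSeries (Fin (n + 3)) k, S = MvPowerSeries.X (Fin.last (n + 2)) ^ 2 +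
              ∑ j : Fin 2, MvPowerSeries.rename (Fin.succAboveEmb (Fin.last (n + 2)))
                (TupleGame.slice i₀ (MvPowerSeries.X 0 * Bv j)) * MvPowerSeries.X (Fin.last (n + 2)) ^ (j : ℕ) →
            CobordantGame.IsSingular k S → good S) ∨
         (∃ (i : Fin (n + 2)) (A' : Fin 2 → MvPowerSeries (Fin (n + 2)) k),
            (∀ j : Fin 2, ((![B₀ + B₁ * φ + φ ^ 2, B₁ + 2 * φ] : Fin 2 → MvPowerSeries (Fin (n + 2)) k) j) =
              MvPowerSeries.X i ^ (2 - (j : ℕ)) * A' j) ∧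
            (∀ j : Fin 2, MvPowerSeries.constantCoeff (A' j) = 0) ∧
            ∀ ci : k, ci ≠ 0 → ∀ S : MvPowerSeries (Fin (n + 3)) k, S = MvPowerSeries.X (Fin.last (n + 2)) ^ 2 +
              ∑ j : Fin 2, MvPowerSeries.rename (Fin.succAboveEmb (Fin.last (n + 2)))
                (MvPowerSeries.C (ci ^ (2 - (j : ℕ))) * TupleGame.slice i
                  (MvPowerSeries.subst (CobordantChart.chart (fun l : Fin (n + 2) => if l = i then 1 else 0)
                    (fun l : Fin (n + 2) => if l = i then ci else 0)) (A' j))) *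
                MvPowerSeries.X (Fin.last (n + 2)) ^ (j : ℕ) →
              CobordantGame.IsSingular k S → good S))) :
    ∀ A₀ A₁ : MvPowerSeries (Fin (n + 2)) k, (2 : ℕ∞) < A₀.order → (1 : ℕ∞) < A₁.order →
      CobordantGame.Won k (n + 3) (MvPowerSeries.X (Fin.last (n + 2)) ^ 2 +
        (MvPowerSeries.rename (Fin.succAboveEmb (Fin.last (n + 2))) A₀ +
          MvPowerSeries.rename (Fin.succAboveEmb (Fin.last (n + 2))) A₁ * MvPowerSeries.X (Fin.last (n + 2)))) := by
  classical
  suffices key : ∀ (α : Ordinal.{0}) (A₀ A₁ : MvPowerSeries (Fin (n + 2)) k), κ A₀ A₁ = α →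
      (2 : ℕ∞) < A₀.order → (1 : ℕ∞) < A₁.order →
      Won k (n + 3) (X (Fin.last (n + 2)) ^ 2 + (rename (Fin.succAboveEmb (Fin.last (n + 2))) A₀ +
        rename (Fin.succAboveEmb (Fin.last (n + 2))) A₁ * X (Fin.last (n + 2)))) from
    fun A₀ A₁ h₀ h₁ => key _ A₀ A₁ rfl h₀ h₁
  intro α
  induction α using WellFoundedLT.induction with
  | ind α ih =>
  intro A₀ A₁ hα hA₀ hA₁
  obtain ⟨θ₀, H₀, B₀, B₁, hθ₀0, hθ₀det, hH₀, hB₀, hB₁, hre, φ, hφ, hC₀, hC₁, hbr⟩ := hstep A₀ A₁ hA₀ hA₁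
  -- re-present: `Won (pos A) ⟸ Won (θ₀^* pos A) = Won (H₀ · pos B) ⟸ Won (pos B)`
  rw [← won_subst_iff hθ₀0 hθ₀det, hre, won_unit_mul_iff hH₀]
  -- re-centre
  rw [← won_monic_two_recentre_iff φ hφ B₀ B₁]
  set C₀ := B₀ + B₁ * φ + φ ^ 2 with hC₀def
  set C₁ := B₁ + 2 * φ with hC₁def
  -- a good singular slice is won
  have hgood : ∀ S : MvPowerSeries (Fin (n + 3)) k, IsSingular k S →
      ((∃ θ : Fin (n + 3) → MvPowerSeries (Fin (n + 3)) k, (∀ i, constantCoeff (θ i) = 0) ∧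
          IsUnit (Matrix.det (Matrix.of fun i j => coeff (Finsupp.single j 1) (θ i))) ∧
          coeff (Finsupp.single 0 2) (subst θ S) = 0 ∧ coeff (Finsupp.single 1 2) (subst θ S) = 0 ∧
          coeff (Finsupp.single 0 1 + Finsupp.single 1 1) (subst θ S) ≠ 0) ∨
        (∃ (θ : Fin (n + 3) → MvPowerSeries (Fin (n + 3)) k) (H : MvPowerSeries (Fin (n + 3)) k)
            (A₀' A₁' : MvPowerSeries (Fin (n + 2)) k),
          (∀ i, constantCoeff (θ i) = 0) ∧ IsUnit (FormalCoordChange.linMat θ).det ∧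
          constantCoeff H ≠ 0 ∧ (2 : ℕ∞) < A₀'.order ∧ (1 : ℕ∞) < A₁'.order ∧
          subst θ S = H * (X (Fin.last (n + 2)) ^ 2 +
            (rename (Fin.succAboveEmb (Fin.last (n + 2))) A₀' +
              rename (Fin.succAboveEmb (Fin.last (n + 2))) A₁' * X (Fin.last (n + 2)))) ∧
          κ A₀' A₁' < κ A₀ A₁)) →
      Won k (n + 3) S := by
    intro S hS hgoodS
    rcases hgoodS with hhyp | ⟨θ, H, A₀', A₁', hθ0, hθdet, hH, hA₀', hA₁', hSeq, hlt⟩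
    · exact TangentConeCut.hyperbolicStartsWon hlow S hS hhyp
    · have hW' := ih _ (hα ▸ hlt) A₀' A₁' rfl hA₀' hA₁'
      have hW : Won k (n + 3) (subst θ S) := by
        rw [hSeq]
        exact (won_unit_mul_iff hH _).mpr hW'
      exact (won_subst_iff hθ0 hθdet S).mp hW
  have hAv : ∀ j : Fin 2, ((2 - (j : ℕ) : ℕ) : ℕ∞) < (((![C₀, C₁] : Fin 2 → MvPowerSeries (Fin (n + 2)) k) j)).order := by
    intro j
    fin_cases j
    · simpa using hC₀
    · simpa using hC₁
  rw [monic_two_eq_sum]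
  rcases hbr with hpoint | ⟨i, A', hdiv, hA'0, hcurve⟩
  · -- the point blow-up
    refine won_monic_of_pointBlowup p hp k (n + 2) 2 two_pos (![C₀, C₁]) hAv fun c i₀ hc Bv hBv hSs => ?_
    exact hgood _ hSs (hpoint c i₀ hc Bv hBv _ rfl hSs)
  · -- the curve blow-up along `V(x_i, y)`
    refine won_monic_of_curveBlowup p hp k (n + 2) 2 two_pos i (![C₀, C₁]) A' hdiv hA'0 fun ci hci hSs => ?_
    exact hgood _ hSs (hcurve ci hci _ rfl hSs)

/-- S2 FROM N4′ (sorry-free given the hypothesis): over `k = k̄` of characteristic `2`, if a rank with the FORMAL step property of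
`monicDoublePointsWon_of_formalRank` (at `n = 0`) exists on the pairs `(A₀, A₁) ∈ k[[x₁,x₂]]²` — statement N4′, the hypothesis
below, spelled out verbatim — then the registered piece S2 `stub_charTwoDoublePointSurfaceWon` of the engine line holds VERBATIM
(`charTwoDoublePointSurfaceWon_of_monicForms` + `PlaneWon.lineWon`).  [OURS · L1 W4.3; N4′ is the S2 sub-stub of skeleton v21.] -/
theorem charTwoDoublePointSurfaceWon_of_formalRank
    (hN4 : ∀ (k : Type) [Field k] [CharP k 2] [IsAlgClosed k],
      ∃ κ : MvPowerSeries (Fin 2) k → MvPowerSeries (Fin 2) k → Ordinal.{0},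
      ∀ A₀ A₁ : MvPowerSeries (Fin 2) k, (2 : ℕ∞) < A₀.order → (1 : ℕ∞) < A₁.order →
      ∃ (θ₀ : Fin 3 → MvPowerSeries (Fin 3) k) (H₀ : MvPowerSeries (Fin 3) k) (B₀ B₁ : MvPowerSeries (Fin 2) k),
        (∀ i, MvPowerSeries.constantCoeff (θ₀ i) = 0) ∧ IsUnit (FormalCoordChange.linMat θ₀).det ∧
        MvPowerSeries.constantCoeff H₀ ≠ 0 ∧ (2 : ℕ∞) < B₀.order ∧ (1 : ℕ∞) < B₁.order ∧
        MvPowerSeries.subst θ₀ (MvPowerSeries.X (Fin.last 2) ^ 2 +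
            (MvPowerSeries.rename (Fin.succAboveEmb (Fin.last 2)) A₀ +
              MvPowerSeries.rename (Fin.succAboveEmb (Fin.last 2)) A₁ * MvPowerSeries.X (Fin.last 2))) =
          H₀ * (MvPowerSeries.X (Fin.last 2) ^ 2 +
            (MvPowerSeries.rename (Fin.succAboveEmb (Fin.last 2)) B₀ +
              MvPowerSeries.rename (Fin.succAboveEmb (Fin.last 2)) B₁ * MvPowerSeries.X (Fin.last 2))) ∧
      ∃ φ : MvPowerSeries (Fin 2) k, MvPowerSeries.constantCoeff φ = 0 ∧
        (2 : ℕ∞) < (B₀ + B₁ * φ + φ ^ 2).order ∧ (1 : ℕ∞) < (B₁ + 2 * φ).order ∧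
        let good : MvPowerSeries (Fin 3) k → Prop := fun S =>
          (∃ θ : Fin 3 → MvPowerSeries (Fin 3) k, (∀ i, MvPowerSeries.constantCoeff (θ i) = 0) ∧
            IsUnit (Matrix.det (Matrix.of fun i j => MvPowerSeries.coeff (Finsupp.single j 1) (θ i))) ∧
            MvPowerSeries.coeff (Finsupp.single 0 2) (MvPowerSeries.subst θ S) = 0 ∧
            MvPowerSeries.coeff (Finsupp.single 1 2) (MvPowerSeries.subst θ S) = 0 ∧
            MvPowerSeries.coeff (Finsupp.single 0 1 + Finsupp.single 1 1) (MvPowerSeries.subst θ S) ≠ 0) ∨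
          (∃ (θ : Fin 3 → MvPowerSeries (Fin 3) k) (H : MvPowerSeries (Fin 3) k) (A₀' A₁' : MvPowerSeries (Fin 2) k),
            (∀ i, MvPowerSeries.constantCoeff (θ i) = 0) ∧ IsUnit (FormalCoordChange.linMat θ).det ∧
            MvPowerSeries.constantCoeff H ≠ 0 ∧ (2 : ℕ∞) < A₀'.order ∧ (1 : ℕ∞) < A₁'.order ∧
            MvPowerSeries.subst θ S =
              H * (MvPowerSeries.X (Fin.last 2) ^ 2 +
                (MvPowerSeries.rename (Fin.succAboveEmb (Fin.last 2)) A₀' +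
                  MvPowerSeries.rename (Fin.succAboveEmb (Fin.last 2)) A₁' * MvPowerSeries.X (Fin.last 2))) ∧
            κ A₀' A₁' < κ A₀ A₁)
        ((∀ (c : Fin 2 → k) (i₀ : Fin 2), c i₀ ≠ 0 → ∀ Bv : Fin 2 → MvPowerSeries (Fin 3) k,
            (∀ j : Fin 2, MvPowerSeries.subst (CobordantChart.chart (fun _ : Fin 2 => 1) c)
              ((![B₀ + B₁ * φ + φ ^ 2, B₁ + 2 * φ] : Fin 2 → MvPowerSeries (Fin 2) k) j) =
              MvPowerSeries.X 0 ^ (2 - (j : ℕ) + 1) * Bv j) →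
            ∀ S : MvPowerSeries (Fin 3) k, S = MvPowerSeries.X (Fin.last 2) ^ 2 +
              ∑ j : Fin 2, MvPowerSeries.rename (Fin.succAboveEmb (Fin.last 2))
                (TupleGame.slice i₀ (MvPowerSeries.X 0 * Bv j)) * MvPowerSeries.X (Fin.last 2) ^ (j : ℕ) →
            CobordantGame.IsSingular k S → good S) ∨
         (∃ (i : Fin 2) (A' : Fin 2 → MvPowerSeries (Fin 2) k),
            (∀ j : Fin 2, ((![B₀ + B₁ * φ + φ ^ 2, B₁ + 2 * φ] : Fin 2 → MvPowerSeries (Fin 2) k) j) =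
              MvPowerSeries.X i ^ (2 - (j : ℕ)) * A' j) ∧
            (∀ j : Fin 2, MvPowerSeries.constantCoeff (A' j) = 0) ∧
            ∀ ci : k, ci ≠ 0 → ∀ S : MvPowerSeries (Fin 3) k, S = MvPowerSeries.X (Fin.last 2) ^ 2 +
              ∑ j : Fin 2, MvPowerSeries.rename (Fin.succAboveEmb (Fin.last 2))
                (MvPowerSeries.C (ci ^ (2 - (j : ℕ))) * TupleGame.slice i
                  (MvPowerSeries.subst (CobordantChart.chart (fun l : Fin 2 => if l = i then 1 else 0)
                    (fun l : Fin 2 => if l = i then ci else 0)) (A' j))) *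
                MvPowerSeries.X (Fin.last 2) ^ (j : ℕ) →
              CobordantGame.IsSingular k S → good S))) :
    ∀ (k : Type) [Field k] [CharP k 2] [IsAlgClosed k],
      (∀ m : ℕ, m < 3 → ∀ g : MvPowerSeries (Fin m) k,
        CobordantGame.IsSingular k g → CobordantGame.Won k m g) →
      ∀ (f : MvPowerSeries (Fin 3) k), CobordantGame.IsSingular k f →
      (∀ g : MvPowerSeries (Fin 3) k, CobordantGame.IsSingular k g → g.order < f.order →
        CobordantGame.Won k 3 g) →
      f.order = 2 →
      (∃ ℓ : Fin 3 → k, ∀ i j : Fin 3,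
        MvPowerSeries.coeff (Finsupp.single i 1 + Finsupp.single j 1) f =
          MvPowerSeries.coeff (Finsupp.single i 1 + Finsupp.single j 1)
            ((∑ l, MvPowerSeries.C (ℓ l) * MvPowerSeries.X l) ^ 2)) →
      CobordantGame.Won k 3 f := by
  refine charTwoDoublePointSurfaceWon_of_monicForms fun k _ _ _ IH A₀ A₁ hA₀ hA₁ => ?_
  obtain ⟨κ, hκ⟩ := hN4 k
  exact monicDoublePointsWon_of_formalRank 2 Nat.prime_two k 0 (fun g hg => IH 1 (by omega) g hg) κ hκ A₀ A₁ hA₀ hA₁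

end Summit.ResolutionOfSingularities.ResolutionOfSingularities.Theorems
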